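import Mathlib
import Literature.MathematicalPhysics.QuantumFieldTheory.LatticeMirrorNormals
import Literature.MathematicalPhysics.QuantumFieldTheory.OSLorentzInvariance
import Literature.MathematicalPhysics.QuantumFieldTheory.PointwiseOSReconstruction
import Literature.Analysis.Complex.BoundedCrossTheoremTwoStrips
import HarnessLib

/-!
# DiamondCross — MOVED (deprecated alias module)

Topic `Literature/Uncategorized`. The named fact formerly parked here by the gate,
`Literature.Uncategorized.DiamondCross` (the bounded cross theorem for two strips; accept-time
relocation of a `[cite]`d proposition written inline in a
`Summits/CriticalPhenomena/Ising3DConformalLimit/Theorems/` proposal, human ruling 2026-08-15), now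
lives — statement byte-identical, together with its discharge — at
`Literature.Analysis.Complex.DiamondCross`
(`Literature/Analysis/Complex/BoundedCrossTheoremTwoStrips.lean`, librarian move p95259,
2026-08-16). This module keeps only a deprecated reducible `abbrev` under the old name, so that the files still
naming `Literature.Uncategorized.DiamondCross` keep compiling (deprecation warning only; each
re-elaborated against this module in a scratch simulation, rc 0):
`Literature/Uncategorized/DiamondCrossHolds.lean` (now itself a deprecated alias of
`Literature.Analysis.Complex.DiamondCross_holds`, p95658),
`Summits/CriticalPhenomena/Ising3DConformalLimit/Theorems/HyperoctahedralRPLimitRotationInvariantDiamondCross.lean`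
(`stub_diamondCross : DiamondCross := Literature.Uncategorized.DiamondCross_holds`) and
`Summits/CriticalPhenomena/Ising3DConformalLimit/Theorems/HyperoctahedralRPLimitRotationInvariantInPlaneLightCone.lean`
(`stub_inPlaneLightCone : DiamondCross → …`, which hands `hD` to Literature theorems typed with the
moved fact — fine through the reducible abbrev). The two former Literature importers
(`MathematicalPhysics/QuantumFieldTheory/MirrorInPlaneConeSupport.lean`, `MirrorInPlaneLightCone.lean`)
were re-pointed to the new home (p96627, p96626) and no longer import this module. The original
imports are kept so that nothing downstream loses a transitive import. Provers: import
`Literature.Analysis.Complex.BoundedCrossTheoremTwoStrips` and use `Literature.Analysis.Complex.DiamondCross`;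
this module can then be deleted.

* `Literature.Uncategorized.DiamondCross` — deprecated `abbrev` of
  `Literature.Analysis.Complex.DiamondCross`.
-/

namespace Literature.Uncategorized

/-- DEPRECATED alias (librarian move 2026-08-16): this constant is, by definition, the moved
`Literature.Analysis.Complex.DiamondCross`
(statement byte-identical there); kept as a reducible `abbrev` so that files naming the old
constant keep elaborating. [folklore] -/
@[deprecated Literature.Analysis.Complex.DiamondCross (since := "2026-08-16")]
abbrev DiamondCross : Prop :=
  Literature.Analysis.Complex.DiamondCross

end Literature.Uncategorized
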